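import Literature.MeasureTheory.Integral.FibreCoordinatesPushforwardDensity
import Mathlib.Analysis.Calculus.ImplicitContDiff
import Mathlib.Analysis.Calculus.FDeriv.Measurable
import Mathlib.MeasureTheory.Measure.Haar.Unique
import Mathlib.MeasureTheory.Measure.Lebesgue.EqHaar

/-!
# THE PUSH-FORWARD OF A DENSITY UNDER A C¹ SUBMERSION HAS A CONTINUOUS DENSITY (locally, near a regular point) — the
# C¹-submersion special case of the co-area ∕ change-of-variables formula ([EvansGariepy1992] §3.4.2–§3.4.3), obtained
# from Mathlib's implicit function theorem and this directory's `FibreCoordinatesPushforwardDensity`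

Generic calculus ∕ measure theory on finite-dimensional real spaces; every declaration is a THEOREM proved here from Mathlib
(no `def`, no named fact, no `sorry`).  LOCATED CONSUMER (cell `pub-ymgap`, YM-PLAN Track A, node N09 [B12] width seat
`pub-ymgap-dag-n09-w2` g3, `--supports` K1⁷ `StabilityBAtRecordR13SepCoPH` = stmt-QuantumFields-20542, count-neutral helper):
node00-def-K0e's located debt (F1) «the Jacobian face of [Balaban1987RG1] (0.4)'s disintegration» (`P7-LOCATOR-AUDIT.md` §4,
`F1-PROGRAMME-DESIGN.md` M3∕M4).  The sibling file `FibreCoordinatesPushforwardDensity` (this seat, p609518) is the M4 engine: GIVEN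
fibre coordinates `Ψ` straightening a block map `M` it produces the explicit, continuous push-forward density.  THIS FILE is the
abstract M3: it BUILDS such fibre coordinates for every measurable map `M : E → Y` between finite-dimensional real spaces that is
`C¹` at a point `a` with SURJECTIVE differential — Mathlib's implicit function theorem (`ImplicitFunctionData.toOpenPartialHomeomorph`,
the chart `x ↦ (M x, π(x − a))`, and `ImplicitFunctionData.contDiffAt_implicitFunction` for the smoothness of its inverse) — and
concludes: **there are open `O ∋ a`, `D ∋ M a` such that for every density `r ≥ 0` on `E`, measurable, continuous and bounded on
`O` and vanishing off `O`, the push-forward `M_*(r·μE)` has ABOVE `D` a density that is CONTINUOUS on `D`**.  In print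
([Balaban1987RG1] (2.1)–(2.10) pp. 265–267) the fibre coordinates are built instead by the linearising change of variables
`B′ = B − hD̃(B)` around the background `V^{(k)}(W)` — that choice controls the INTEGRAND (small-field expansions); for the mere
existence of a continuous version of the transform any `C¹` straightening does, which is what is proved here.

WHAT IS PROVED (namespace `Literature.MeasureTheory.Integral.SubmersionPushforward`).
* §1 `exists_haarFactor_lintegral_comp_equiv` — transport of `∫ F(L x) dμE` along a linear identification `L : E ≃L Y × K`
  (Haar uniqueness: `μE.map L = c • (μY ⊗ μK)`, `0 < c < ∞`; Mathlib `Measure.isAddLeftInvariant_eq_smul`).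
* §2 ★★★ **`exists_continuousOn_density_map_of_submersion`** — the statement above, for every finite-dimensional real `E`, `Y`
  with additive Haar measures `μE`, `μY`.  Proof: `f' := DM(a)`, `K := ker f'`; the implicit-function chart
  `φ = (M, π(· − a)) : E ⊇ source → Y × K` with `C¹` inverse near `φ a = (M a, 0)`; a product window `D ×ˢ V` (balls of one
  radius) inside a compact ball inside the `C¹`-region bounds `|det D(L ∘ φ⁻¹)|`; `O := φ⁻¹(D ×ˢ V)`; the M4 engine
  `FibreCoordinates.continuousOn_density_of_fibreCoordinates` applies in the model `Y × K` to `Ψ := L ∘ φ⁻¹` (straightening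
  `M ∘ L⁻¹`), and §1 transports the identity back to `E`.

HONEST SCOPE.  (i) Local statement near ONE regular point; `r` must vanish off the chart neighbourhood `O` (a partition of unity
over a compact regular region is not done here).  (ii) The density is obtained as `c · ∫_V |det D(L∘φ⁻¹)(W,B)| r(φ⁻¹(W,B)) dB`
for SOME linear identification `L` and Haar constant `c` — its VALUE is chart-dependent bookkeeping, its existence and continuity
are not.  (iii) Nothing model-specific: no claim about Bałaban's averaging (whose `C¹`-submersion property through the group
chart is the consumer's input), about N09, or about the Clay problem.

v1.1 (same seat, g5; APPEND-ONLY, §1–§2 byte-identical to p610570): §3 `exists_continuousOn_density_map_of_submersion_pos` — the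
§2 statement with the extra conjunct `0 < r a → 0 < I (M a)` (positivity of the local density at the base point), for the
positivity half (F3) of the located consumer's regularity tower.
-/

noncomputable section

namespace Literature.MeasureTheory.Integral.SubmersionPushforward

open _root_.MeasureTheory _root_.MeasureTheory.Measure Set Function Filter Metric
open scoped ENNReal NNReal Topology

variable {E Y : Type*}
  [NormedAddCommGroup E] [NormedSpace ℝ E] [FiniteDimensional ℝ E] [MeasurableSpace E] [BorelSpace E]
  [NormedAddCommGroup Y] [NormedSpace ℝ Y] [FiniteDimensional ℝ Y] [MeasurableSpace Y] [BorelSpace Y]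

/-! ## §1 Transport along a linear identification `E ≃L Y × K` -/

section Transport

variable {K : Type*} [NormedAddCommGroup K] [NormedSpace ℝ K] [FiniteDimensional ℝ K] [MeasurableSpace K] [BorelSpace K]

omit [FiniteDimensional ℝ E] in
/-- **Transport of the push-forward identity along a linear identification.**  For `L : E ≃L Y × K` there is a constant
`0 < c < ∞` (the Haar factor of `L`) with `∫ 1_{M⁻¹A}(x) ρ(x) dμE = c · ∫ 1_{(M∘L⁻¹)⁻¹A}(y) ρ(L⁻¹y) d(μY ⊗ μK)` for every
measurable `A` and every measurable `ρ ≥ 0` — uniqueness of Haar measure (`Measure.isAddLeftInvariant_eq_smul`) and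
`lintegral_map_equiv`. [cite: EvansGariepy1992, §3.3.3 Thm 2 (linear special case)] -/
theorem exists_haarFactor_lintegral_comp_equiv (μE : Measure E) [μE.IsAddHaarMeasure] (μY : Measure Y) [μY.IsAddHaarMeasure]
    (μK : Measure K) [μK.IsAddHaarMeasure] (L : E ≃L[ℝ] Y × K) :
    ∃ c : ℝ≥0, 0 < c ∧ ∀ (F : Y × K → ℝ≥0∞), Measurable F →
      ∫⁻ x, F (L x) ∂μE = c * ∫⁻ y, F y ∂(μY.prod μK) := by
  haveI : (μE.map L).IsAddHaarMeasure := L.isAddHaarMeasure_map μE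
  refine ⟨addHaarScalarFactor (μE.map L) (μY.prod μK), addHaarScalarFactor_pos_of_isAddHaarMeasure _ _, fun F hF => ?_⟩
  have hmap : μE.map L = addHaarScalarFactor (μE.map L) (μY.prod μK) • (μY.prod μK) :=
    isAddLeftInvariant_eq_smul _ _
  calc ∫⁻ x, F (L x) ∂μE = ∫⁻ y, F y ∂(μE.map L.toHomeomorph.toMeasurableEquiv) :=
        (lintegral_map_equiv F L.toHomeomorph.toMeasurableEquiv).symm
    _ = ∫⁻ y, F y ∂(μE.map L) := rfl
    _ = ∫⁻ y, F y ∂(addHaarScalarFactor (μE.map L) (μY.prod μK) • (μY.prod μK)) := by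
        congr 1
    _ = _ := by
        rw [lintegral_smul_measure]
        simp [ENNReal.smul_def, smul_eq_mul]

end Transport

/-! ## §2 The push-forward under a C¹ submersion has a continuous density near a regular point -/

section Submersion

/-- ★★★ **THE PUSH-FORWARD OF A DENSITY UNDER A `C¹` SUBMERSION HAS A CONTINUOUS DENSITY, LOCALLY.**  `E`, `Y` finite-dimensional
real normed spaces with additive Haar measures `μE`, `μY`; `M : E → Y` measurable, `C¹` at `a` with surjective differential
`DM(a)`.  Then there are open sets `O ∋ a` in `E` and `D ∋ M a` in `Y` such that for EVERY density `r ≥ 0` on `E` that is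
measurable, continuous and bounded on `O` and vanishes off `O`, there is `I : Y → ℝ`, `I ≥ 0`, CONTINUOUS ON `D`, with
`(r·μE)(M⁻¹ A) = ∫_A I dμY` for every Borel `A ⊆ D` — i.e. `I` is a density of the push-forward `M_*(r·μE)` above `D`.
(Implicit-function fibre coordinates + `FibreCoordinates.continuousOn_density_of_fibreCoordinates` + §1.)
[cite: EvansGariepy1992, §3.4.2 Thm 1 and §3.4.3 Thm 2 (C¹-submersion special case)] [cite: Balaban1987RG1, (2.1)–(2.10) pp.265–267 (measure-level reading)] -/
theorem exists_continuousOn_density_map_of_submersion (μE : Measure E) [μE.IsAddHaarMeasure] (μY : Measure Y)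
    [μY.IsAddHaarMeasure] {M : E → Y} (hMm : Measurable M) {a : E} (hM : ContDiffAt ℝ 1 M a)
    (hsurj : (fderiv ℝ M a).range = ⊤) :
    ∃ O : Set E, IsOpen O ∧ a ∈ O ∧ ∃ D : Set Y, IsOpen D ∧ M a ∈ D ∧
      ∀ r : E → ℝ, Measurable r → (∀ x, 0 ≤ r x) → ContinuousOn r O → (∃ C, ∀ x ∈ O, r x ≤ C) →
        (∀ x, x ∉ O → r x = 0) →
        ∃ I : Y → ℝ, ContinuousOn I D ∧ (∀ W, 0 ≤ I W) ∧
          ∀ A : Set Y, MeasurableSet A → A ⊆ D →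
            (μE.withDensity fun x => ENNReal.ofReal (r x)) (M ⁻¹' A) = ∫⁻ W in A, ENNReal.ofReal (I W) ∂μY := by
  classical
  haveI : CompleteSpace E := FiniteDimensional.complete ℝ E
  haveI : CompleteSpace Y := FiniteDimensional.complete ℝ Y
  -- the differential and the implicit-function chart `φ = (M, π(· − a))`
  set f' : E →L[ℝ] Y := fderiv ℝ M a with hf'def
  have hf : HasStrictFDerivAt M f' a := hM.hasStrictFDerivAt one_ne_zero
  have hker : f'.ker.ClosedComplemented := f'.ker_closedComplemented_of_finiteDimensional_range
  haveI : CompleteSpace f'.ker := FiniteDimensional.complete ℝ f'.ker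
  letI : MeasurableSpace f'.ker := borel f'.ker
  haveI : BorelSpace f'.ker := ⟨rfl⟩
  set 𝒟 : ImplicitFunctionData ℝ E Y f'.ker := HasStrictFDerivAt.implicitFunctionDataOfComplemented M f' hf hsurj hker
    with h𝒟
  set φ := 𝒟.toOpenPartialHomeomorph with hφ
  have hφ1 : ∀ x, (φ x).1 = M x := fun x => rfl
  have ha : a ∈ φ.source := 𝒟.pt_mem_toOpenPartialHomeomorph_source
  have hφa : φ a = (M a, 0) := by
    rw [hφ, ImplicitFunctionData.toOpenPartialHomeomorph_apply]
    simp [h𝒟]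
  -- `φ.symm` is C¹ at `φ a`
  have hsm : ContDiffAt ℝ 1 φ.symm (φ a) := by
    have hr : ContDiffAt ℝ 1 𝒟.rightFun 𝒟.pt := by
      show ContDiffAt ℝ 1 (fun x => Classical.choose hker (x - a)) a
      exact (Classical.choose hker).contDiff.contDiffAt.comp a (contDiffAt_id.sub contDiffAt_const)
    have h := ImplicitFunctionData.contDiffAt_implicitFunction (φ := 𝒟) (n := 1) hM hr one_ne_zero
    rw [ImplicitFunctionData.implicitFunction_def, Function.uncurry_curry] at h
    exact h
  -- a neighbourhood of `φ a` inside the target on which `φ.symm` is C¹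
  obtain ⟨W', hW'sub, hW'o, haW'⟩ : ∃ W' : Set (Y × f'.ker), W' ⊆ {p | ContDiffAt ℝ 1 φ.symm p} ∩ φ.target ∧
      IsOpen W' ∧ φ a ∈ W' := by
    have h1 : ∀ᶠ p in 𝓝 (φ a), ContDiffAt ℝ 1 φ.symm p := hsm.eventually (by simp)
    have h2 : ∀ᶠ p in 𝓝 (φ a), p ∈ φ.target := φ.open_target.mem_nhds (φ.map_source ha)
    obtain ⟨W', hW', hW'o, hmem⟩ := _root_.eventually_nhds_iff.1 (h1.and h2)
    exact ⟨W', fun p hp => hW' p hp, hW'o, hmem⟩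
  have hW't : W' ⊆ φ.target := fun p hp => (hW'sub hp).2
  have hsmOn : ContDiffOn ℝ 1 φ.symm W' := fun p hp => (show ContDiffAt ℝ 1 φ.symm p from (hW'sub hp).1).contDiffWithinAt
  have hdiff : ∀ p ∈ W', HasFDerivAt φ.symm (fderiv ℝ φ.symm p) p := fun p hp =>
    ((show ContDiffAt ℝ 1 φ.symm p from (hW'sub hp).1).differentiableAt one_ne_zero).hasFDerivAt
  have hcontD : ContinuousOn (fderiv ℝ φ.symm) W' := hsmOn.continuousOn_fderiv_of_isOpen hW'o le_rfl
  -- a linear identification `L : E ≃L Y × ker f'`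
  have hrank : Module.finrank ℝ E = Module.finrank ℝ (Y × f'.ker) := by
    have h1 := LinearMap.finrank_range_add_finrank_ker (f' : E →ₗ[ℝ] Y)
    have h2 : Module.finrank ℝ (LinearMap.range (f' : E →ₗ[ℝ] Y)) = Module.finrank ℝ Y := by
      rw [show LinearMap.range (f' : E →ₗ[ℝ] Y) = ⊤ from hsurj, finrank_top]
    rw [Module.finrank_prod, ← h1, h2]
  set L : E ≃L[ℝ] Y × f'.ker := ContinuousLinearEquiv.ofFinrankEq hrank with hL
  -- radii: a compact ball inside `W'`, and the product window of half the radius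
  obtain ⟨ε, hε, hεW⟩ : ∃ ε > 0, closedBall (φ a) ε ⊆ W' := nhds_basis_closedBall.mem_iff.1 (hW'o.mem_nhds haW')
  set D : Set Y := ball (M a) (ε / 2) with hD
  set V : Set f'.ker := ball 0 (ε / 2) with hV
  set U : Set (Y × f'.ker) := D ×ˢ V with hU
  have hε2 : 0 < ε / 2 := by positivity
  have hUball : U = ball (φ a) (ε / 2) := by rw [hU, hD, hV, hφa, ball_prod_same]
  have hUW : U ⊆ W' := by
    rw [hUball]; exact (ball_subset_closedBall.trans (closedBall_subset_closedBall (by linarith))).trans hεW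
  have hUt : U ⊆ φ.target := hUW.trans hW't
  have hUo : IsOpen U := by rw [hUball]; exact isOpen_ball
  have hUm : MeasurableSet U := hUo.measurableSet
  have haU : φ a ∈ U := by rw [hUball]; exact mem_ball_self hε2
  -- bound for the Jacobian of `L ∘ φ.symm` on the compact ball
  have hJcont : ContinuousOn (fun p => ((L : E →L[ℝ] Y × f'.ker).comp (fderiv ℝ φ.symm p)).det) W' :=
    ContinuousLinearMap.continuous_det.comp_continuousOn
      (((ContinuousLinearMap.compL ℝ (Y × f'.ker) E (Y × f'.ker)) (L : E →L[ℝ] Y × f'.ker)).continuous.comp_continuousOn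
        hcontD)
  obtain ⟨CJ, hCJ⟩ : ∃ CJ, ∀ p ∈ closedBall (φ a) ε,
      ‖((L : E →L[ℝ] Y × f'.ker).comp (fderiv ℝ φ.symm p)).det‖ ≤ CJ :=
    (isCompact_closedBall (φ a) ε).exists_bound_of_continuousOn (hJcont.mono hεW)
  -- the chart neighbourhood `O = φ.symm (U)`
  set O : Set E := φ.symm '' U with hO
  have hOo : IsOpen O := φ.isOpen_image_symm_of_subset_target hUo hUt
  have haO : a ∈ O := ⟨φ a, haU, φ.left_inv ha⟩
  refine ⟨O, hOo, haO, D, isOpen_ball, mem_ball_self hε2, ?_⟩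
  intro r hrm hr0 hrc hrb hrO
  obtain ⟨Cr, hCr⟩ := hrb
  -- the model objects on `Y × ker f'`
  set Ψ : Y × f'.ker → Y × f'.ker := U.piecewise (fun p => L (φ.symm p)) (fun _ => L a) with hΨ
  set Ψ' : Y × f'.ker → (Y × f'.ker →L[ℝ] Y × f'.ker) :=
    fun p => (L : E →L[ℝ] Y × f'.ker).comp (fderiv ℝ φ.symm p) with hΨ'
  set M' : Y × f'.ker → Y := fun y => M (L.symm y) with hM'
  set r' : Y × f'.ker → ℝ := fun y => r (L.symm y) with hr'
  have hΨU : ∀ p ∈ U, Ψ p = L (φ.symm p) := fun p hp => by rw [hΨ, piecewise_eq_of_mem _ _ _ hp]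
  -- hypotheses of the M4 engine
  have hΨ'w : ∀ p ∈ U, HasFDerivWithinAt Ψ (Ψ' p) U p := by
    intro p hp
    have h : HasFDerivAt (fun q => L (φ.symm q)) (Ψ' p) p :=
      (L : E →L[ℝ] Y × f'.ker).hasFDerivAt.comp p (hdiff p (hUW hp))
    exact h.hasFDerivWithinAt.congr (fun q hq => hΨU q hq) (hΨU p hp)
  have hinj : InjOn Ψ U := by
    intro p hp q hq hpq
    rw [hΨU p hp, hΨU q hq] at hpq
    have h := L.injective hpq
    exact φ.symm.injOn (φ.symm_source.symm ▸ hUt hp) (φ.symm_source.symm ▸ hUt hq) h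
  have hΨm : Measurable Ψ := by
    refine ContinuousOn.measurable_piecewise ?_ continuousOn_const hUm
    exact L.continuous.comp_continuousOn (φ.continuousOn_symm.mono hUt)
  have hJm : Measurable fun p => (Ψ' p).det :=
    ContinuousLinearMap.continuous_det.measurable.comp
      (((ContinuousLinearMap.compL ℝ (Y × f'.ker) E (Y × f'.ker)) (L : E →L[ℝ] Y × f'.ker)).continuous.measurable.comp
        (measurable_fderiv ℝ φ.symm))
  have hM'm : Measurable M' := hMm.comp L.symm.continuous.measurable
  have hM'Ψ : ∀ p ∈ U, M' (Ψ p) = p.1 := by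
    intro p hp
    rw [hΨU p hp, hM']
    show M (L.symm (L (φ.symm p))) = p.1
    rw [L.symm_apply_apply, ← hφ1, φ.right_inv (hUt hp)]
  have hr'm : Measurable r' := hrm.comp L.symm.continuous.measurable
  have hr'0 : ∀ y, 0 ≤ r' y := fun y => hr0 _
  have hsupp : ∀ y, M' y ∈ D → y ∉ Ψ '' U → r' y = 0 := by
    intro y _ hy
    apply hrO
    rintro ⟨p, hp, hpy⟩
    exact hy ⟨p, hp, by rw [hΨU p hp, hpy, L.apply_symm_apply]⟩
  have hcontI : ContinuousOn (fun p => |(Ψ' p).det| * r' (Ψ p)) (D ×ˢ V) := by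
    rw [← hU]
    refine ContinuousOn.mul ((continuous_abs.comp_continuousOn (hJcont.mono hUW))) ?_
    have h1 : ContinuousOn (fun p => r (φ.symm p)) U :=
      hrc.comp (φ.continuousOn_symm.mono hUt) (fun p hp => ⟨p, hp, rfl⟩)
    refine h1.congr (fun p hp => ?_)
    show r (L.symm (Ψ p)) = r (φ.symm p)
    rw [hΨU p hp, L.symm_apply_apply]
  have hCI : ∀ p ∈ D ×ˢ V, |(Ψ' p).det| * r' (Ψ p) ≤ max CJ 0 * max Cr 0 := by
    intro p hp
    rw [← hU] at hp
    have h1 : |(Ψ' p).det| ≤ max CJ 0 :=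
      (le_trans (by simpa [Real.norm_eq_abs] using hCJ p ((ball_subset_closedBall.trans
        (closedBall_subset_closedBall (by linarith))) (hUball ▸ hp))) (le_max_left _ _))
    have h2 : r' (Ψ p) ≤ max Cr 0 := by
      have : r' (Ψ p) = r (φ.symm p) := by
        show r (L.symm (Ψ p)) = r (φ.symm p); rw [hΨU p hp, L.symm_apply_apply]
      rw [this]
      exact (hCr _ ⟨p, hp, rfl⟩).trans (le_max_left _ _)
    exact mul_le_mul h1 h2 (hr'0 _) (le_max_of_le_right le_rfl)
  have hVm : MeasurableSet V := isOpen_ball.measurableSet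
  have hDm : MeasurableSet D := isOpen_ball.measurableSet
  have hVfin : (Measure.addHaar : Measure f'.ker) V ≠ ∞ := (measure_ball_lt_top).ne
  -- the M4 engine in the model `Y × ker f'`
  obtain ⟨hIcont, hIdens⟩ := FibreCoordinates.continuousOn_density_of_fibreCoordinates μY
    (Measure.addHaar : Measure f'.ker) hDm hVm hVfin hU hΨ'w hinj hΨm hJm hM'm hM'Ψ hr'm hr'0 hsupp hcontI hCI
  -- transport back to `E` along `L`
  obtain ⟨c, hc, hcid⟩ := exists_haarFactor_lintegral_comp_equiv μE μY (Measure.addHaar : Measure f'.ker) L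
  set I₀ : Y → ℝ := fun W => ∫ B in V, |(Ψ' (W, B)).det| * r' (Ψ (W, B)) ∂(Measure.addHaar : Measure f'.ker) with hI₀
  have hI₀0 : ∀ W, 0 ≤ I₀ W := fun W =>
    setIntegral_nonneg hVm fun B _ => mul_nonneg (abs_nonneg _) (hr'0 _)
  refine ⟨fun W => (c : ℝ) * I₀ W, (continuousOn_const.mul hIcont), fun W => mul_nonneg c.coe_nonneg (hI₀0 W), ?_⟩
  intro A hA hAD
  have hpre : M ⁻¹' A = L ⁻¹' (M' ⁻¹' A) := by
    ext x
    simp only [mem_preimage, hM', L.symm_apply_apply]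
  calc (μE.withDensity fun x => ENNReal.ofReal (r x)) (M ⁻¹' A)
      = ∫⁻ x, (M ⁻¹' A).indicator (fun x => ENNReal.ofReal (r x)) x ∂μE := by
        rw [withDensity_apply _ (hMm hA), lintegral_indicator (hMm hA)]
    _ = ∫⁻ x, (M' ⁻¹' A).indicator (fun y => ENNReal.ofReal (r' y)) (L x) ∂μE := by
        refine lintegral_congr (fun x => ?_)
        rw [hpre]
        simp only [indicator, mem_preimage, hr', L.symm_apply_apply]
    _ = c * ∫⁻ y, (M' ⁻¹' A).indicator (fun y => ENNReal.ofReal (r' y)) y ∂(μY.prod Measure.addHaar) :=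
        hcid _ (((ENNReal.measurable_ofReal.comp hr'm)).indicator (hM'm hA))
    _ = c * ((μY.prod (Measure.addHaar : Measure f'.ker)).withDensity fun y => ENNReal.ofReal (r' y)) (M' ⁻¹' A) := by
        rw [withDensity_apply _ (hM'm hA), lintegral_indicator (hM'm hA)]
    _ = c * ∫⁻ W in A, ENNReal.ofReal (I₀ W) ∂μY := by rw [hIdens A hA hAD]
    _ = ∫⁻ W in A, ENNReal.ofReal ((c : ℝ) * I₀ W) ∂μY := by
        rw [← lintegral_const_mul' _ _ ENNReal.coe_ne_top]
        refine lintegral_congr (fun W => ?_)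
        rw [ENNReal.ofReal_mul c.coe_nonneg, ENNReal.ofReal_coe_nnreal]

end Submersion

/-! ## §3 The same, with POSITIVITY of the density at the base point (v1.1, same seat, APPEND-ONLY; §1–§2 byte-identical) -/

section SubmersionPos

/-- ★★★ **v1.1 — THE LOCAL PUSH-FORWARD DENSITY IS POSITIVE AT `M a` WHEN THE DENSITY IS POSITIVE AT `a`.**  Same hypotheses and
same conclusion as `exists_continuousOn_density_map_of_submersion` (windows `O ∋ a`, `D ∋ M a`; for every measurable `r ≥ 0`
continuous and bounded on `O`, vanishing off `O`, a density `I ≥ 0` of `M_*(r·μE)` above `D`, continuous on `D`), with ONE MORE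
CONJUNCT: `0 < r a → 0 < I (M a)`.  Proof: the density is `c · ∫_V |det D(L∘φ⁻¹)(W,B)|·r(φ⁻¹(W,B)) dB` with `c > 0`; at `W = M a`
the integrand is continuous in `B` on the window `V ∋ 0` and equals `|det D(L∘φ⁻¹)(φ a)|·r(a) > 0` at `B = 0` (the differential of
the implicit-function chart at `a` is a linear isomorphism, `OpenPartialHomeomorph.hasStrictFDerivAt_symm`), so the integral over the
open window is positive (`setIntegral_pos_iff_support_of_nonneg_ae`, additive Haar measure charges open sets).  LOCATED CONSUMER:
the positivity half (F3) of node N09's road-B regularity tower (the log in [Balaban1987RG1] (0.19) is taken of a transform that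
must be POSITIVE on the next small-field domain). [cite: EvansGariepy1992, §3.4.2 Thm 1 and §3.4.3 Thm 2 (C¹-submersion special case)]
[cite: Balaban1987RG1, (2.10) p.267 and (0.19) p.255 (measure-level reading)] -/
theorem exists_continuousOn_density_map_of_submersion_pos (μE : Measure E) [μE.IsAddHaarMeasure] (μY : Measure Y)
    [μY.IsAddHaarMeasure] {M : E → Y} (hMm : Measurable M) {a : E} (hM : ContDiffAt ℝ 1 M a)
    (hsurj : (fderiv ℝ M a).range = ⊤) :
    ∃ O : Set E, IsOpen O ∧ a ∈ O ∧ ∃ D : Set Y, IsOpen D ∧ M a ∈ D ∧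
      ∀ r : E → ℝ, Measurable r → (∀ x, 0 ≤ r x) → ContinuousOn r O → (∃ C, ∀ x ∈ O, r x ≤ C) →
        (∀ x, x ∉ O → r x = 0) →
        ∃ I : Y → ℝ, ContinuousOn I D ∧ (∀ W, 0 ≤ I W) ∧ (0 < r a → 0 < I (M a)) ∧
          ∀ A : Set Y, MeasurableSet A → A ⊆ D →
            (μE.withDensity fun x => ENNReal.ofReal (r x)) (M ⁻¹' A) = ∫⁻ W in A, ENNReal.ofReal (I W) ∂μY := by
  classical
  haveI : CompleteSpace E := FiniteDimensional.complete ℝ E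
  haveI : CompleteSpace Y := FiniteDimensional.complete ℝ Y
  -- the differential and the implicit-function chart `φ = (M, π(· − a))`
  set f' : E →L[ℝ] Y := fderiv ℝ M a with hf'def
  have hf : HasStrictFDerivAt M f' a := hM.hasStrictFDerivAt one_ne_zero
  have hker : f'.ker.ClosedComplemented := f'.ker_closedComplemented_of_finiteDimensional_range
  haveI : CompleteSpace f'.ker := FiniteDimensional.complete ℝ f'.ker
  letI : MeasurableSpace f'.ker := borel f'.ker
  haveI : BorelSpace f'.ker := ⟨rfl⟩
  set 𝒟 : ImplicitFunctionData ℝ E Y f'.ker := HasStrictFDerivAt.implicitFunctionDataOfComplemented M f' hf hsurj hker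
    with h𝒟
  set φ := 𝒟.toOpenPartialHomeomorph with hφ
  have hφ1 : ∀ x, (φ x).1 = M x := fun x => rfl
  have ha : a ∈ φ.source := 𝒟.pt_mem_toOpenPartialHomeomorph_source
  have hφa : φ a = (M a, 0) := by
    rw [hφ, ImplicitFunctionData.toOpenPartialHomeomorph_apply]
    simp [h𝒟]
  -- the chart's differential at `a` is a linear isomorphism; so is the differential of `φ.symm` at `φ a`
  set e𝒟 : E ≃L[ℝ] Y × f'.ker := 𝒟.leftDeriv.equivProdOfSurjectiveOfIsCompl 𝒟.rightDeriv 𝒟.range_leftDeriv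
    𝒟.range_rightDeriv 𝒟.isCompl_ker with he𝒟
  have hφ' : HasStrictFDerivAt φ (e𝒟 : E →L[ℝ] Y × f'.ker) a := by
    rw [hφ, ImplicitFunctionData.toOpenPartialHomeomorph_coe]; exact 𝒟.hasStrictFDerivAt
  have hsymm : HasStrictFDerivAt φ.symm (e𝒟.symm : (Y × f'.ker) →L[ℝ] E) (φ a) :=
    φ.hasStrictFDerivAt_symm (φ.map_source ha) (by rw [φ.left_inv ha]; exact hφ')
  -- `φ.symm` is C¹ at `φ a`
  have hsm : ContDiffAt ℝ 1 φ.symm (φ a) := by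
    have hr : ContDiffAt ℝ 1 𝒟.rightFun 𝒟.pt := by
      show ContDiffAt ℝ 1 (fun x => Classical.choose hker (x - a)) a
      exact (Classical.choose hker).contDiff.contDiffAt.comp a (contDiffAt_id.sub contDiffAt_const)
    have h := ImplicitFunctionData.contDiffAt_implicitFunction (φ := 𝒟) (n := 1) hM hr one_ne_zero
    rw [ImplicitFunctionData.implicitFunction_def, Function.uncurry_curry] at h
    exact h
  -- a neighbourhood of `φ a` inside the target on which `φ.symm` is C¹
  obtain ⟨W', hW'sub, hW'o, haW'⟩ : ∃ W' : Set (Y × f'.ker), W' ⊆ {p | ContDiffAt ℝ 1 φ.symm p} ∩ φ.target ∧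
      IsOpen W' ∧ φ a ∈ W' := by
    have h1 : ∀ᶠ p in 𝓝 (φ a), ContDiffAt ℝ 1 φ.symm p := hsm.eventually (by simp)
    have h2 : ∀ᶠ p in 𝓝 (φ a), p ∈ φ.target := φ.open_target.mem_nhds (φ.map_source ha)
    obtain ⟨W', hW', hW'o, hmem⟩ := _root_.eventually_nhds_iff.1 (h1.and h2)
    exact ⟨W', fun p hp => hW' p hp, hW'o, hmem⟩
  have hW't : W' ⊆ φ.target := fun p hp => (hW'sub hp).2
  have hsmOn : ContDiffOn ℝ 1 φ.symm W' := fun p hp => (show ContDiffAt ℝ 1 φ.symm p from (hW'sub hp).1).contDiffWithinAt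
  have hdiff : ∀ p ∈ W', HasFDerivAt φ.symm (fderiv ℝ φ.symm p) p := fun p hp =>
    ((show ContDiffAt ℝ 1 φ.symm p from (hW'sub hp).1).differentiableAt one_ne_zero).hasFDerivAt
  have hcontD : ContinuousOn (fderiv ℝ φ.symm) W' := hsmOn.continuousOn_fderiv_of_isOpen hW'o le_rfl
  -- a linear identification `L : E ≃L Y × ker f'`
  have hrank : Module.finrank ℝ E = Module.finrank ℝ (Y × f'.ker) := by
    have h1 := LinearMap.finrank_range_add_finrank_ker (f' : E →ₗ[ℝ] Y)
    have h2 : Module.finrank ℝ (LinearMap.range (f' : E →ₗ[ℝ] Y)) = Module.finrank ℝ Y := by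
      rw [show LinearMap.range (f' : E →ₗ[ℝ] Y) = ⊤ from hsurj, finrank_top]
    rw [Module.finrank_prod, ← h1, h2]
  set L : E ≃L[ℝ] Y × f'.ker := ContinuousLinearEquiv.ofFinrankEq hrank with hL
  -- radii: a compact ball inside `W'`, and the product window of half the radius
  obtain ⟨ε, hε, hεW⟩ : ∃ ε > 0, closedBall (φ a) ε ⊆ W' := nhds_basis_closedBall.mem_iff.1 (hW'o.mem_nhds haW')
  set D : Set Y := ball (M a) (ε / 2) with hD
  set V : Set f'.ker := ball 0 (ε / 2) with hV
  set U : Set (Y × f'.ker) := D ×ˢ V with hU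
  have hε2 : 0 < ε / 2 := by positivity
  have hUball : U = ball (φ a) (ε / 2) := by rw [hU, hD, hV, hφa, ball_prod_same]
  have hUW : U ⊆ W' := by
    rw [hUball]; exact (ball_subset_closedBall.trans (closedBall_subset_closedBall (by linarith))).trans hεW
  have hUt : U ⊆ φ.target := hUW.trans hW't
  have hUo : IsOpen U := by rw [hUball]; exact isOpen_ball
  have hUm : MeasurableSet U := hUo.measurableSet
  have haU : φ a ∈ U := by rw [hUball]; exact mem_ball_self hε2
  -- bound for the Jacobian of `L ∘ φ.symm` on the compact ball
  have hJcont : ContinuousOn (fun p => ((L : E →L[ℝ] Y × f'.ker).comp (fderiv ℝ φ.symm p)).det) W' :=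
    ContinuousLinearMap.continuous_det.comp_continuousOn
      (((ContinuousLinearMap.compL ℝ (Y × f'.ker) E (Y × f'.ker)) (L : E →L[ℝ] Y × f'.ker)).continuous.comp_continuousOn
        hcontD)
  obtain ⟨CJ, hCJ⟩ : ∃ CJ, ∀ p ∈ closedBall (φ a) ε,
      ‖((L : E →L[ℝ] Y × f'.ker).comp (fderiv ℝ φ.symm p)).det‖ ≤ CJ :=
    (isCompact_closedBall (φ a) ε).exists_bound_of_continuousOn (hJcont.mono hεW)
  -- the chart neighbourhood `O = φ.symm (U)`
  set O : Set E := φ.symm '' U with hO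
  have hOo : IsOpen O := φ.isOpen_image_symm_of_subset_target hUo hUt
  have haO : a ∈ O := ⟨φ a, haU, φ.left_inv ha⟩
  refine ⟨O, hOo, haO, D, isOpen_ball, mem_ball_self hε2, ?_⟩
  intro r hrm hr0 hrc hrb hrO
  obtain ⟨Cr, hCr⟩ := hrb
  -- the model objects on `Y × ker f'`
  set Ψ : Y × f'.ker → Y × f'.ker := U.piecewise (fun p => L (φ.symm p)) (fun _ => L a) with hΨ
  set Ψ' : Y × f'.ker → (Y × f'.ker →L[ℝ] Y × f'.ker) :=
    fun p => (L : E →L[ℝ] Y × f'.ker).comp (fderiv ℝ φ.symm p) with hΨ'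
  set M' : Y × f'.ker → Y := fun y => M (L.symm y) with hM'
  set r' : Y × f'.ker → ℝ := fun y => r (L.symm y) with hr'
  have hΨU : ∀ p ∈ U, Ψ p = L (φ.symm p) := fun p hp => by rw [hΨ, piecewise_eq_of_mem _ _ _ hp]
  -- hypotheses of the M4 engine
  have hΨ'w : ∀ p ∈ U, HasFDerivWithinAt Ψ (Ψ' p) U p := by
    intro p hp
    have h : HasFDerivAt (fun q => L (φ.symm q)) (Ψ' p) p :=
      (L : E →L[ℝ] Y × f'.ker).hasFDerivAt.comp p (hdiff p (hUW hp))
    exact h.hasFDerivWithinAt.congr (fun q hq => hΨU q hq) (hΨU p hp)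
  have hinj : InjOn Ψ U := by
    intro p hp q hq hpq
    rw [hΨU p hp, hΨU q hq] at hpq
    have h := L.injective hpq
    exact φ.symm.injOn (φ.symm_source.symm ▸ hUt hp) (φ.symm_source.symm ▸ hUt hq) h
  have hΨm : Measurable Ψ := by
    refine ContinuousOn.measurable_piecewise ?_ continuousOn_const hUm
    exact L.continuous.comp_continuousOn (φ.continuousOn_symm.mono hUt)
  have hJm : Measurable fun p => (Ψ' p).det :=
    ContinuousLinearMap.continuous_det.measurable.comp
      (((ContinuousLinearMap.compL ℝ (Y × f'.ker) E (Y × f'.ker)) (L : E →L[ℝ] Y × f'.ker)).continuous.measurable.comp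
        (measurable_fderiv ℝ φ.symm))
  have hM'm : Measurable M' := hMm.comp L.symm.continuous.measurable
  have hM'Ψ : ∀ p ∈ U, M' (Ψ p) = p.1 := by
    intro p hp
    rw [hΨU p hp, hM']
    show M (L.symm (L (φ.symm p))) = p.1
    rw [L.symm_apply_apply, ← hφ1, φ.right_inv (hUt hp)]
  have hr'm : Measurable r' := hrm.comp L.symm.continuous.measurable
  have hr'0 : ∀ y, 0 ≤ r' y := fun y => hr0 _
  have hsupp : ∀ y, M' y ∈ D → y ∉ Ψ '' U → r' y = 0 := by
    intro y _ hy
    apply hrO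
    rintro ⟨p, hp, hpy⟩
    exact hy ⟨p, hp, by rw [hΨU p hp, hpy, L.apply_symm_apply]⟩
  have hcontI : ContinuousOn (fun p => |(Ψ' p).det| * r' (Ψ p)) (D ×ˢ V) := by
    rw [← hU]
    refine ContinuousOn.mul ((continuous_abs.comp_continuousOn (hJcont.mono hUW))) ?_
    have h1 : ContinuousOn (fun p => r (φ.symm p)) U :=
      hrc.comp (φ.continuousOn_symm.mono hUt) (fun p hp => ⟨p, hp, rfl⟩)
    refine h1.congr (fun p hp => ?_)
    show r (L.symm (Ψ p)) = r (φ.symm p)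
    rw [hΨU p hp, L.symm_apply_apply]
  have hCI : ∀ p ∈ D ×ˢ V, |(Ψ' p).det| * r' (Ψ p) ≤ max CJ 0 * max Cr 0 := by
    intro p hp
    rw [← hU] at hp
    have h1 : |(Ψ' p).det| ≤ max CJ 0 :=
      (le_trans (by simpa [Real.norm_eq_abs] using hCJ p ((ball_subset_closedBall.trans
        (closedBall_subset_closedBall (by linarith))) (hUball ▸ hp))) (le_max_left _ _))
    have h2 : r' (Ψ p) ≤ max Cr 0 := by
      have : r' (Ψ p) = r (φ.symm p) := by
        show r (L.symm (Ψ p)) = r (φ.symm p); rw [hΨU p hp, L.symm_apply_apply]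
      rw [this]
      exact (hCr _ ⟨p, hp, rfl⟩).trans (le_max_left _ _)
    exact mul_le_mul h1 h2 (hr'0 _) (le_max_of_le_right le_rfl)
  have hVm : MeasurableSet V := isOpen_ball.measurableSet
  have hDm : MeasurableSet D := isOpen_ball.measurableSet
  have hVfin : (Measure.addHaar : Measure f'.ker) V ≠ ∞ := (measure_ball_lt_top).ne
  -- the M4 engine in the model `Y × ker f'`
  obtain ⟨hIcont, hIdens⟩ := FibreCoordinates.continuousOn_density_of_fibreCoordinates μY
    (Measure.addHaar : Measure f'.ker) hDm hVm hVfin hU hΨ'w hinj hΨm hJm hM'm hM'Ψ hr'm hr'0 hsupp hcontI hCI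
  -- transport back to `E` along `L`
  obtain ⟨c, hc, hcid⟩ := exists_haarFactor_lintegral_comp_equiv μE μY (Measure.addHaar : Measure f'.ker) L
  set I₀ : Y → ℝ := fun W => ∫ B in V, |(Ψ' (W, B)).det| * r' (Ψ (W, B)) ∂(Measure.addHaar : Measure f'.ker) with hI₀
  have hI₀0 : ∀ W, 0 ≤ I₀ W := fun W =>
    setIntegral_nonneg hVm fun B _ => mul_nonneg (abs_nonneg _) (hr'0 _)
  refine ⟨fun W => (c : ℝ) * I₀ W, (continuousOn_const.mul hIcont), fun W => mul_nonneg c.coe_nonneg (hI₀0 W), ?_, ?_⟩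
  · -- POSITIVITY AT THE BASE POINT: the fibre integrand at `(M a, 0)` is `|det D(L∘φ⁻¹)(φ a)|·r(a) > 0` and continuous in `B`
    intro hra
    have hcpos : (0 : ℝ) < c := by exact_mod_cast hc
    refine mul_pos hcpos ?_
    have hMaD : M a ∈ D := mem_ball_self hε2
    have h0V : (0 : f'.ker) ∈ V := mem_ball_self hε2
    set g : f'.ker → ℝ := fun B => |(Ψ' (M a, B)).det| * r' (Ψ (M a, B)) with hg
    show 0 < ∫ B in V, g B ∂(Measure.addHaar : Measure f'.ker)
    -- continuity of `g` on `V` (restriction of the joint continuity to the slice `{M a} × V`)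
    have hslice : ContinuousOn (fun B : f'.ker => ((M a, B) : Y × f'.ker)) V :=
      (continuous_const.prodMk continuous_id).continuousOn
    have hgc : ContinuousOn g V := hcontI.comp hslice (fun B hB => show ((M a, B) : Y × f'.ker) ∈ D ×ˢ V from ⟨hMaD, hB⟩)
    -- the value at `B = 0`
    have hΨ0 : Ψ (M a, 0) = L a := by
      rw [← hφa, hΨU _ haU, φ.left_inv ha]
    have hr'0a : r' (Ψ (M a, 0)) = r a := by
      rw [hΨ0]; show r (L.symm (L a)) = r a; rw [L.symm_apply_apply]
    have hdet : (Ψ' (M a, 0)).det ≠ 0 := by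
      rw [← hφa]
      have hD : fderiv ℝ φ.symm (φ a) = (e𝒟.symm : (Y × f'.ker) →L[ℝ] E) := hsymm.hasFDerivAt.fderiv
      have hΨ'eq : Ψ' (φ a) = ((e𝒟.symm.trans L : (Y × f'.ker) ≃L[ℝ] (Y × f'.ker)) : (Y × f'.ker) →L[ℝ] (Y × f'.ker)) := by
        refine ContinuousLinearMap.ext fun v => ?_
        show ((L : E →L[ℝ] Y × f'.ker).comp (fderiv ℝ φ.symm (φ a))) v = L (e𝒟.symm v)
        rw [hD]; rfl
      rw [hΨ'eq]
      exact (LinearEquiv.isUnit_det' (e𝒟.symm.trans L).toLinearEquiv).ne_zero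
    have hg0 : 0 < g 0 := by
      show 0 < |(Ψ' (M a, 0)).det| * r' (Ψ (M a, 0))
      rw [hr'0a]
      exact mul_pos (abs_pos.2 hdet) hra
    -- integrability of `g` on the finite-measure window and a.e. non-negativity
    have hgm : Measurable g := by
      have h1 : Measurable fun B : f'.ker => ((M a, B) : Y × f'.ker) := measurable_const.prodMk measurable_id
      exact ((continuous_abs.measurable.comp (hJm.comp h1))).mul (hr'm.comp (hΨm.comp h1))
    have hgint : IntegrableOn g V (Measure.addHaar : Measure f'.ker) := by
      refine Measure.integrableOn_of_bounded (M := max CJ 0 * max Cr 0) hVfin hgm.aestronglyMeasurable ?_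
      refine (ae_restrict_iff' hVm).2 (Filter.Eventually.of_forall fun B hB => ?_)
      rw [Real.norm_of_nonneg (mul_nonneg (abs_nonneg _) (hr'0 _))]
      exact hCI (M a, B) ⟨hMaD, hB⟩
    have hg0ae : 0 ≤ᵐ[(Measure.addHaar : Measure f'.ker).restrict V] g :=
      Filter.Eventually.of_forall fun B => mul_nonneg (abs_nonneg _) (hr'0 _)
    refine (setIntegral_pos_iff_support_of_nonneg_ae hg0ae hgint).2 ?_
    -- the support of `g` contains an open neighbourhood of `0` inside `V`
    have hev : ∀ᶠ B in 𝓝[V] (0 : f'.ker), g 0 / 2 < g B :=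
      (hgc 0 h0V).eventually (Ioi_mem_nhds (by linarith))
    obtain ⟨O', hO'mem, hO'⟩ := (eventually_nhdsWithin_iff.1 hev).exists_mem
    obtain ⟨O'', hO''O', hO''o, h0O''⟩ := _root_.mem_nhds_iff.1 hO'mem
    have hsub : O'' ∩ V ⊆ support g ∩ V := by
      rintro B ⟨hB1, hB2⟩
      refine ⟨?_, hB2⟩
      have h := hO' B (hO''O' hB1) hB2
      exact (lt_of_le_of_lt (by linarith [hg0.le]) h).ne'
    refine lt_of_lt_of_le ?_ (measure_mono hsub)
    exact (hO''o.inter isOpen_ball).measure_pos _ ⟨0, h0O'', h0V⟩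
  intro A hA hAD
  have hpre : M ⁻¹' A = L ⁻¹' (M' ⁻¹' A) := by
    ext x
    simp only [mem_preimage, hM', L.symm_apply_apply]
  calc (μE.withDensity fun x => ENNReal.ofReal (r x)) (M ⁻¹' A)
      = ∫⁻ x, (M ⁻¹' A).indicator (fun x => ENNReal.ofReal (r x)) x ∂μE := by
        rw [withDensity_apply _ (hMm hA), lintegral_indicator (hMm hA)]
    _ = ∫⁻ x, (M' ⁻¹' A).indicator (fun y => ENNReal.ofReal (r' y)) (L x) ∂μE := by
        refine lintegral_congr (fun x => ?_)
        rw [hpre]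
        simp only [indicator, mem_preimage, hr', L.symm_apply_apply]
    _ = c * ∫⁻ y, (M' ⁻¹' A).indicator (fun y => ENNReal.ofReal (r' y)) y ∂(μY.prod Measure.addHaar) :=
        hcid _ (((ENNReal.measurable_ofReal.comp hr'm)).indicator (hM'm hA))
    _ = c * ((μY.prod (Measure.addHaar : Measure f'.ker)).withDensity fun y => ENNReal.ofReal (r' y)) (M' ⁻¹' A) := by
        rw [withDensity_apply _ (hM'm hA), lintegral_indicator (hM'm hA)]
    _ = c * ∫⁻ W in A, ENNReal.ofReal (I₀ W) ∂μY := by rw [hIdens A hA hAD]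
    _ = ∫⁻ W in A, ENNReal.ofReal ((c : ℝ) * I₀ W) ∂μY := by
        rw [← lintegral_const_mul' _ _ ENNReal.coe_ne_top]
        refine lintegral_congr (fun W => ?_)
        rw [ENNReal.ofReal_mul c.coe_nonneg, ENNReal.ofReal_coe_nnreal]


end SubmersionPos

end Literature.MeasureTheory.Integral.SubmersionPushforward

end
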